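import Summits.AtomisticToContinuum.Crystallization.Theses.FrustrationRangeCertificates

/-!
# Route `FrustrationRangeCertificates`, item stmt-AtomisticToContinuum-12978 `Assembly`

The assembly item of the route:
`PatternPricedCertificates → TrialStateUpper → CrysPeriodicMinAttained → CertificatesEnergyLimit →
CertificatesDefectVanish → DefectVanishCrystallizes → Crystallization`.

Pure logic plus the proved Literature fact `LennardJonesMinimalDistance_holds`
(`Literature/MathematicalPhysics/StatisticalMechanics/LennardJonesClusters.lean`):
from `CrysPeriodicMinAttained` take the periodic minimiser `P` with `IsLeast`; the energy hinge
`CertificatesEnergyLimit` gives `E(N)/N → ⨅_Q e(Q)`, and `⨅_Q e(Q) = e(P)` by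
`IsLeast.csInf_eq` (after `← sInf_range`), which is `HasPeriodicGroundStateEnergy lennardJones 3`;
the positional hinge `CertificatesDefectVanish` gives `BulkDefectVanish`, and
`DefectVanishCrystallizes` with `LennardJonesMinimalDistance_holds` gives
`IsCrystallizing lennardJones 3`.  The pair is `_root_.Crystallization`
(= `Literature.MathematicalPhysics.StatisticalMechanics.Crystallization`).  [cite: BlancLewin2015, §2.1]
-/

namespace Summit.AtomisticToContinuum.Crystallization.Theorems

open Literature.MathematicalPhysics.StatisticalMechanics
open Summit.AtomisticToContinuum.Crystallization.Theses.FrustrationRangeCertificates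

/-- **Item stmt-AtomisticToContinuum-12978** (`Assembly`, route `FrustrationRangeCertificates`):
`PatternPricedCertificates → TrialStateUpper → CrysPeriodicMinAttained → CertificatesEnergyLimit →
CertificatesDefectVanish → DefectVanishCrystallizes → Crystallization`.
Energetic conjunct: the attained periodic minimiser `P` of `CrysPeriodicMinAttained` and the limit
`E(N)/N → ⨅_Q e(Q) = e(P)` from the energy hinge; positional conjunct: the positional hinge gives
`BulkDefectVanish`, and the soft assembly lemma with the proved minimal-distance fact
`LennardJonesMinimalDistance_holds` gives `IsCrystallizing lennardJones 3`. -/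
theorem frustrationRangeCertificates_assembly_proof :
    Summit.AtomisticToContinuum.Crystallization.Theses.FrustrationRangeCertificates.Assembly := by
  unfold Summit.AtomisticToContinuum.Crystallization.Theses.FrustrationRangeCertificates.Assembly
  intro hC hU hMin hE hD hDVC
  obtain ⟨P, hP⟩ := hMin
  have hlim : CrysEnergyLimit := hE hC hU ⟨P, hP⟩
  refine ⟨⟨P, hP, ?_⟩, hDVC (hD hC hU) LennardJonesMinimalDistance_holds⟩
  unfold Summit.AtomisticToContinuum.Crystallization.Theses.FrustrationRangeCertificates.CrysEnergyLimit
    at hlim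
  rw [← sInf_range, hP.csInf_eq] at hlim
  exact hlim

end Summit.AtomisticToContinuum.Crystallization.Theorems
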